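import Literature.Probability.RandomPlanarGeometry.SAWWidePolygonsJoinCount
import Literature.Probability.RandomPlanarGeometry.SAWPolygonDiameterClasses
import Literature.Probability.RandomPlanarGeometry.SAWPolygonClasses
import HarnessLib

/-!
# DGHM20 Lemma 3.3 in polygon-count form: wide polygons from all polygons of a given length

Topic `Literature/Probability/RandomPlanarGeometry` (assembles `SAWPolygonDiameterClasses.lean` — dyadic
diameter pigeonhole and rotation — with `SAWWidePolygonsJoinCount.lean` — the join `J(p, τ(q))` and its
counting inequality).

Source: H. Duminil-Copin, S. Ganguly, A. Hammond, I. Manolescu, *Bounding the number of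
self-avoiding walks: Hammersley–Welsh with polygon insertion*, Ann. Probab. 48 (2020),
arXiv:1809.00760, Lemma 3.3 and its proof (p. 10–11): for every `m` there is `u ∈ [m^{1/2}, m]`
with `|WSAP^u_{4m+4}| ≥ (2u+1)^{-1} (|SAP_{2m+2}| / (2 log₂ m))²`, combined there with Lemma 1.6
(`|SAP_{2m+2}| ≥ |SAB_m|² / poly(m)`) into
`|WSAP^u_{4m+4}| ≥ (log 2)² 3^{-3} 2^{-14} (log u)^{-2} u^{-21} |SAB_m|⁴`.

## Contents (namespace `Literature.Probability.RandomPlanarGeometry.SAW`), PROVED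

* **`sq_card_normPolygons_le_widePolygons`** — for every `N` there is a width scale `u` with
  `√N ≤ u + 1`, `u ≤ 2N + 1` and
  `|SAP_N|² ≤ 8 (log₂(N+1) + 1)² · ((2u+1) (4N+1)² · |WSAP^u_{2N}| + 1)`:
  the polygon-count form of Lemma 3.3 (`N = 2m+2`), with cruder polynomial factors than the source
  (lossy injectivity of the join, dyadic classes indexed by `log₂(diam+1)`); only polynomial orders
  matter for the abundance statements built on it.

* `frequently_sq_lower_le_widePolygons` — **DGHM20 Proposition 3.1, raw subsequential form on `ℤ²`**
  (unconditional): for every `s > 1`, for infinitely many `M` there is a width scale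
  `u ∈ [√(2M+2) − 1, 4M+5]` with
  `(M^{-(2s+8)} μ^{2M} / (1296 (4M+5)²))² ≤ 8 (log₂(2M+3)+1)² ((2u+1)(8M+9)² |WSAP^u_{4M+4}| + 1)` —
  the chain Kesten divergence → bridges → rooted polygons → classes (`SAWPolygonClasses.lean`) → wide
  polygons (this file). The source's clean form `|WSAP^u_m| ≥ u^{-α} μ^m` (`α > 29`, `m ≤ 4u²+4`, `u` in
  an infinite set) follows by absorbing the polynomial factors for large `u`; that bookkeeping is left
  to the consumer.

## Not here

The every-scale ("for all large `u`") abundance — open on `ℤ²` (DGHM prove it on the hexagonal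
lattice, Proposition 3.2, by the parafermionic observable).
-/

noncomputable section

open Finset SimpleGraph Literature.Probability.LatticeModels Literature.Probability.Percolation
open Literature.Probability.Percolation.SiteGadgetSystem (vertsOf mem_vertsOf)

namespace Literature.Probability.RandomPlanarGeometry.SAW

/-- **DGHM20 Lemma 3.3, polygon-count form (crude constants).** For every `N` there is `u` with
`√N ≤ u + 1 ≤ 2N + 2` and `|SAP_N|² ≤ 8 (log₂(N+1)+1)² ((2u+1)(4N+1)² |WSAP^u_{2N}| + 1)`.
(Dyadic pigeonhole over `j = log₂(diam+1)`, rotation so that `width ≥ height`, then the join: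
`u = 2^{j+1} − 1`, widths `≥ 2^j − 1`, heights `≤ 2^{j+1} − 2`.)
[cite: DuminilCopinGangulyHammondManolescu2020, Lemma 3.3] -/
theorem sq_card_normPolygons_le_widePolygons (N : ℕ) : ∃ u : ℕ, Nat.sqrt N ≤ u ∧ u ≤ 2 * N + 1 ∧
    (normPolygons N).card ^ 2 ≤ 8 * (Nat.log 2 (N + 1) + 1) ^ 2 *
      ((2 * u + 1) * (4 * N + 1) ^ 2 * (widePolygons u (2 * N)).card + 1) := by
  classical
  obtain ⟨j, hjL, hcard, hmem⟩ := exists_heavy_wideLow_class N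
  set S := normPolygons N with hS
  set L := Nat.log 2 (N + 1) with hL
  set A := S.filter (fun E => diamClass E = j ∧ yExt E ≤ xExt E) with hA
  have hpowj : 1 ≤ 2 ^ j := Nat.one_le_two_pow
  have hpow : 2 ^ (j + 1) = 2 * 2 ^ j := by ring
  have hpow2 : 2 ^ (j + 2) = 4 * 2 ^ j := by ring
  by_cases hA0 : A.card = 0
  · -- degenerate case: the heavy class is empty, so `|SAP_N| ≤ 2(L+1)`
    refine ⟨N, Nat.sqrt_le_self N, by omega, ?_⟩
    rw [hA0] at hcard
    have h1 : S.card ≤ 2 * (L + 1) := by simpa using hcard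
    calc S.card ^ 2 ≤ (2 * (L + 1)) ^ 2 := Nat.pow_le_pow_left h1 2
      _ = 4 * (L + 1) ^ 2 * 1 := by ring
      _ ≤ 8 * (L + 1) ^ 2 * ((2 * N + 1) * (4 * N + 1) ^ 2 * (widePolygons N (2 * N)).card + 1) := by
          gcongr
          · norm_num
          · exact Nat.le_add_left 1 _
  · -- the scale
    set u := 2 ^ (j + 1) - 1 with hu
    obtain ⟨E, hE⟩ := Finset.card_pos.1 (Nat.pos_of_ne_zero hA0)
    obtain ⟨-, -, hlow, hup⟩ := hmem E hE
    have hES : E ∈ S := (Finset.mem_filter.1 hE).1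
    have hNsq : N ≤ (diamExt E + 1) ^ 2 := card_le_sq_diamExt_succ hES
    have hdN : diamExt E ≤ N := diamExt_le_card hES
    refine ⟨u, ?_, ?_, ?_⟩
    · -- `√N ≤ u`: `N ≤ (d+1)² < (u+1)²`
      have : N < (u + 1) ^ 2 := by
        have h1 : diamExt E + 1 ≤ u := by omega
        calc N ≤ (diamExt E + 1) ^ 2 := hNsq
          _ ≤ u ^ 2 := Nat.pow_le_pow_left h1 2
          _ < (u + 1) ^ 2 := Nat.pow_lt_pow_left (by omega) (by norm_num)
      exact Nat.le_of_lt_succ (Nat.sqrt_lt'.2 this)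
    · -- `u ≤ 2N + 1`: `u + 1 = 2^{j+1} ≤ 2(d+1) ≤ 2(N+1)`
      omega
    · -- the join inequality on the heavy class
      have hP : ∀ p ∈ A, p ∈ normPolygons N ∧ HasWidthGe p (2 ^ j - 1) ∧ HasHeightLe p (2 ^ (j + 1) - 2) :=
        fun p hp => ⟨(Finset.mem_filter.1 hp).1, (hmem p hp).1, (hmem p hp).2.1⟩
      have huw : u ≤ 2 * (2 ^ j - 1) + 1 := by omega
      have hhu : 2 * (2 ^ (j + 1) - 2) ≤ 16 * u := by omega
      have hsq := sq_card_le_card_widePolygons A hP huw hhu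
      -- `(2h+1) ≤ 2u+1`
      have hh' : 2 * (2 ^ (j + 1) - 2) + 1 ≤ 2 * u + 1 := by omega
      have hsq' : A.card ^ 2 ≤ (2 * u + 1) * (4 * N + 1) ^ 2 * (widePolygons u (2 * N)).card :=
        hsq.trans (Nat.mul_le_mul_right _ (Nat.mul_le_mul_right _ hh'))
      -- `|S| ≤ 2(L+1)(|A|+1)` and `(|A|+1)² ≤ 2|A|² + 2`
      have h1 : S.card ≤ 2 * (L + 1) * (A.card + 1) := by
        have := hcard
        linarith
      have h2 : (A.card + 1) ^ 2 ≤ 2 * A.card ^ 2 + 2 := by nlinarith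
      calc S.card ^ 2 ≤ (2 * (L + 1) * (A.card + 1)) ^ 2 := Nat.pow_le_pow_left h1 2
        _ = 4 * (L + 1) ^ 2 * (A.card + 1) ^ 2 := by ring
        _ ≤ 4 * (L + 1) ^ 2 * (2 * A.card ^ 2 + 2) := Nat.mul_le_mul_left _ h2
        _ = 8 * (L + 1) ^ 2 * (A.card ^ 2 + 1) := by ring
        _ ≤ 8 * (L + 1) ^ 2 * ((2 * u + 1) * (4 * N + 1) ^ 2 * (widePolygons u (2 * N)).card + 1) :=
            Nat.mul_le_mul_left _ (Nat.add_le_add_right hsq' 1)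

/-- **DGHM20 Proposition 3.1 on `ℤ²`, raw subsequential form (unconditional).** For every `s > 1`,
for infinitely many `M` there is `u` with `√(2M+2) ≤ u + 1`, `u ≤ 4M+5` and
`(M^{-(2s+8)} μ^{2M} / (1296 (4M+5)²))² ≤ 8 (log₂(2M+3)+1)² ((2u+1)(8M+9)² |WSAP^u_{4M+4}| + 1)`:
subsequential polygon abundance (`frequently_le_card_normPolygons`, from Kesten's bridge divergence)
fed into Lemma 3.3 (`sq_card_normPolygons_le_widePolygons`). The printed form
("for all `u ∈ A`, `A` infinite, there exists `m ∈ ⟦4u+4, 4u²+4⟧` with `|WSAP^u_m| ≥ u^{-α} μ^m`",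
`α > 29`) differs by polynomial bookkeeping only.
[cite: DuminilCopinGangulyHammondManolescu2020, Proposition 3.1] -/
theorem frequently_sq_lower_le_widePolygons {s : ℝ} (hs : 1 < s) :
    ∃ᶠ M : ℕ in Filter.atTop, ∃ u : ℕ, Nat.sqrt (2 * M + 2) ≤ u ∧ u ≤ 2 * (2 * M + 2) + 1 ∧
      ((M : ℝ) ^ (-(2 * s + 8)) / 1296 * Zd.connectiveConstant 2 ^ (2 * M) /
          ((2 * (2 * M + 2) + 1) ^ 2 : ℝ)) ^ 2 ≤
        (8 * (Nat.log 2 (2 * M + 2 + 1) + 1) ^ 2 *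
          ((2 * u + 1) * (4 * (2 * M + 2) + 1) ^ 2 * (widePolygons u (2 * (2 * M + 2))).card + 1) : ℕ) := by
  refine (frequently_le_card_normPolygons hs).mono fun M hM => ?_
  obtain ⟨u, hu1, hu2, hsq⟩ := sq_card_normPolygons_le_widePolygons (2 * M + 2)
  refine ⟨u, hu1, hu2, ?_⟩
  have hX : 0 ≤ (M : ℝ) ^ (-(2 * s + 8)) / 1296 * Zd.connectiveConstant 2 ^ (2 * M) /
      ((2 * (2 * M + 2) + 1) ^ 2 : ℝ) := by
    have := (Zd.connectiveConstant_pos 2)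
    positivity
  have h2 : ((M : ℝ) ^ (-(2 * s + 8)) / 1296 * Zd.connectiveConstant 2 ^ (2 * M) /
      ((2 * (2 * M + 2) + 1) ^ 2 : ℝ)) ^ 2 ≤ (((normPolygons (2 * M + 2)).card : ℝ)) ^ 2 :=
    pow_le_pow_left₀ hX hM 2
  refine h2.trans ?_
  exact_mod_cast hsq

end Literature.Probability.RandomPlanarGeometry.SAW
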